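import Mathlib.Data.Real.Basic
import Mathlib.Algebra.Order.BigOperators.Ring.Finset
import Mathlib.Algebra.Order.Field.Basic
import Literature.Probability.LatticeModels.BattleFederbushTrees
import Literature.Combinatorics.SimpleGraph.SpanningTreeParentMap
import HarnessLib

/-!
# Crux `AnchorGap` (stmt-QuantumFields-11141), line `registered` — stub TREESUM, part 1

Generic finite combinatorics behind the Battle–Federbush "extra `1/(n−1)!`" (the geometric bound
behind the Kotecký–Preiss condition of the Gaussian cluster expansion), for the registered stub
`stub_treeWeightPolymerSum` (proved in `SmallCircleAnchorAnchorGapTreeWeightPolymerSum.lean`).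
Everything is [folklore] over the tree's `BattleFederbushTrees` / `CayleyForests` /
`SpanningTreeParentMap` vocabulary; no definition, no named fact.

* §1 `lineSets_sum_le_forests_sum` — the anchored cluster trees `BattleFederbush.lineSets v X`
  inject into the parent maps on `X` rooted at `v` (`IsForestOn X {v}`), a line set being the
  edge set `{{x, t x} : x ≠ v}` of the parent map of its scripts; tree sums with line weights
  `y ≥ 0` are bounded by the corresponding sums over parent maps.
* §2 `sum_pos_prod_le` — PEELING LEAVES: roots pinned at `b`, row sums `≤ Y` ⇒ the position sum
  of `∏ y {e u, e (t u)}` over the `n` non-root labels is `≤ Y ^ n` (the induction of the tree's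
  `PolymerTreeSum.sum_lineProd_le`, for `Sym2`-weights).
Part 2 (`…TreeWeightLabelling`): re-rooting and labelling; part 3 (`…TreeWeightPolymerSum`): the stub.
-/

set_option autoImplicit false

namespace Summit.QuantumFields.YangMills.Theorems.AnchorGap.TreeSum

open Finset Function Literature.Combinatorics.Enumerative Literature.Probability.LatticeModels

section Lines

/-! ### §1 From anchored cluster trees (line sets) to parent maps rooted at the anchor -/

variable {β : Type} [DecidableEq β]

/-- In a rooted forest with a single root `v`, the lines `{x, t x}` of distinct non-root vertices
are distinct (a coincidence would be a 2-cycle of the parent map, which never reaches the root).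
[folklore] -/
theorem line_injOn {X : Finset β} {v : β} {t : β → β} (ht : IsForestOn X {v} t) :
    Set.InjOn (fun x => s(x, t x)) ↑(X \ {v}) := by
  intro x hx x' hx' h
  rw [Finset.coe_sdiff, Finset.coe_singleton, Set.mem_sdiff, Finset.mem_coe,
    Set.mem_singleton_iff] at hx hx'
  rcases Sym2.eq_iff.1 h with ⟨hxx, -⟩ | ⟨hxt, htx⟩
  · exact hxx
  · -- a 2-cycle `t x = x'`, `t x' = x`: the iterates of `x` stay in `{x, x'}` and never reach `v`
    exfalso
    obtain ⟨n, hn⟩ := ht.2 x hx.1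
    have key : ∀ k : ℕ, t^[k] x = x ∨ t^[k] x = x' := by
      intro k
      induction k with
      | zero => exact Or.inl rfl
      | succ k ih =>
        rw [Function.iterate_succ_apply']
        rcases ih with h1 | h1
        · rw [h1]; exact Or.inr htx
        · rw [h1]; exact Or.inl hxt.symm
    rcases key n with h1 | h1
    · exact hx.2 (by simpa [h1] using hn)
    · exact hx'.2 (by simpa [h1] using hn)

/-- The line product of an anchored cluster tree written on its parent map. [folklore] -/
theorem prod_image_line {X : Finset β} {v : β} {t : β → β} (ht : IsForestOn X {v} t)
    (y : Sym2 β → ℝ) :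
    ∏ ℓ ∈ (X \ {v}).image (fun x => s(x, t x)), y ℓ = ∏ x ∈ X \ {v}, y s(x, t x) :=
  Finset.prod_image fun x hx x' hx' h => line_injOn ht (by simpa using hx) (by simpa using hx') h

variable [Fintype β]

/-- **Anchored cluster trees ↪ parent maps.** The tree sum over the line sets `lineSets v X` of
the Battle–Brydges–Federbush scripts is at most the sum over the rooted forests on `X` with the
single root `v` of the product of the line weights `y {x, t x}` over the non-root vertices (each
line set is the edge set of the parent map of any of its scripts,
`BattleFederbush.Script.lines_toFinset_eq_image_parentMap`, and distinct line sets have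
distinct parent maps). [folklore] -/
theorem lineSets_sum_le_forests_sum {y : Sym2 β → ℝ} (hy : ∀ ℓ, 0 ≤ y ℓ) (v : β) (X : Finset β) :
    ∑ T ∈ BattleFederbush.lineSets v X, ∏ ℓ ∈ T, y ℓ
      ≤ ∑ t ∈ forests X {v}, ∏ x ∈ X \ {v}, y s(x, t x) := by
  classical
  -- choose a parent map for each line set
  have hex : ∀ T : BattleFederbush.lineSets v X, ∃ t : β → β, t ∈ forests X {v} ∧
      (T : Finset (Sym2 β)) = (X \ {v}).image fun x => s(x, t x) := by
    rintro ⟨T, hT⟩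
    obtain ⟨k, -, s, hs, hW, rfl⟩ := BattleFederbush.mem_lineSets.1 hT
    subst hW
    exact ⟨s.parentMap, mem_forests.2 (BattleFederbush.Script.isForestOn_parentMap s hs),
      BattleFederbush.Script.lines_toFinset_eq_image_parentMap s hs⟩
  choose Φ hΦ using hex
  have hinj : Function.Injective Φ := by
    intro T T' h
    apply Subtype.ext
    rw [(hΦ T).2, (hΦ T').2, h]
  -- rewrite the sum over line sets as a sum over the attached subtype and push forward
  have h1 : ∑ T ∈ BattleFederbush.lineSets v X, ∏ ℓ ∈ T, y ℓ
      = ∑ T : BattleFederbush.lineSets v X, ∏ x ∈ X \ {v}, y s(x, Φ T x) := by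
    rw [← Finset.sum_coe_sort]
    refine Finset.sum_congr rfl fun T _ => ?_
    rw [← prod_image_line (mem_forests.1 (hΦ T).1) y, ← (hΦ T).2]
  rw [h1]
  calc ∑ T : BattleFederbush.lineSets v X, ∏ x ∈ X \ {v}, y s(x, Φ T x)
      = ∑ t ∈ Finset.univ.image Φ, ∏ x ∈ X \ {v}, y s(x, t x) := by
        rw [Finset.sum_image fun T _ T' _ h => hinj h]
    _ ≤ ∑ t ∈ forests X {v}, ∏ x ∈ X \ {v}, y s(x, t x) := by
        refine Finset.sum_le_sum_of_subset_of_nonneg ?_ fun t _ _ => prod_nonneg fun _ _ => hy _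
        intro t ht
        obtain ⟨T, -, rfl⟩ := Finset.mem_image.1 ht
        exact (hΦ T).1

end Lines

/-! ### §2 Summing the positions of a labelled rooted forest (leaf peeling) -/

section Peel

variable {α : Type} [DecidableEq α]

/-- A non-root vertex is moved by the parent map. [folklore] -/
theorem apply_ne_self_of_mem_sdiff {S R : Finset α} {t : α → α} (ht : IsForestOn S R t) {v : α}
    (hv : v ∈ S \ R) : t v ≠ v := by
  intro hfix
  obtain ⟨n, hn⟩ := ht.2 v (mem_sdiff.1 hv).1
  have : t^[n] v = v := Function.iterate_fixed hfix n
  rw [this] at hn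
  exact (mem_sdiff.1 hv).2 hn

/-- A rooted forest with a non-root vertex has a LEAF: a non-root vertex which is nobody's
parent (a non-root vertex of maximal depth). [folklore] -/
theorem exists_leaf {S R : Finset α} {t : α → α} (ht : IsForestOn S R t) (hne : (S \ R).Nonempty) :
    ∃ ℓ ∈ S \ R, ∀ v ∈ S \ R, t v ≠ ℓ := by
  classical
  have hdepth : ∀ v ∈ S, ∃ n : ℕ, t^[n] v ∈ R := ht.2
  let depth : α → ℕ := fun v => if hv : v ∈ S then Nat.find (hdepth v hv) else 0
  obtain ⟨ℓ, hℓ, hmax⟩ := exists_max_image (S \ R) depth hne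
  refine ⟨ℓ, hℓ, fun v hv htv => ?_⟩
  have hvS : v ∈ S := (mem_sdiff.1 hv).1
  have hℓS : ℓ ∈ S := (mem_sdiff.1 hℓ).1
  have hdv : depth v = Nat.find (hdepth v hvS) := by simp [depth, hvS]
  have hdl : depth ℓ = Nat.find (hdepth ℓ hℓS) := by simp [depth, hℓS]
  have hv_spec : t^[depth v] v ∈ R := by rw [hdv]; exact Nat.find_spec (hdepth v hvS)
  have hv_pos : 0 < depth v := by
    rw [hdv, Nat.find_pos]
    simpa using (mem_sdiff.1 hv).2
  have hℓ_reach : t^[depth v - 1] ℓ ∈ R := by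
    have hd : depth v = (depth v - 1) + 1 := (Nat.sub_add_cancel hv_pos).symm
    rw [hd, Function.iterate_succ_apply, htv] at hv_spec
    exact hv_spec
  have hle : depth ℓ ≤ depth v - 1 := by rw [hdl]; exact Nat.find_min' _ hℓ_reach
  have := hmax v hv
  omega

variable [Fintype α] {β : Type} [Fintype β]

/-- The POSITION ASSIGNMENTS with free labels `F` — labels in `F` range over `β`, every other
label is pinned at `b` — are the members of
`Fintype.piFinset fun i => if i ∈ F then univ else {b}`. [folklore] -/
theorem mem_pos {F : Finset α} {b : β} {e : α → β} :
    e ∈ Fintype.piFinset (fun i => if i ∈ F then (univ : Finset β) else {b}) ↔ ∀ i ∉ F, e i = b := by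
  rw [Fintype.mem_piFinset]
  constructor
  · intro h i hi; simpa [hi] using h i
  · intro h i
    by_cases hi : i ∈ F
    · simp [hi]
    · simpa [hi] using h i hi

/-- **Summing the positions of a labelled rooted forest against symmetric pair weights** (the
tree-graph bound by PEELING LEAVES): if `y ≥ 0` has row sums `Σ_{a'} y {a, a'} ≤ Y`, then for a
rooted forest `t` on the labels `S` with roots `R ⊆ S` and `n` non-root labels, summing the
positions of the non-root labels (roots pinned at `b`) of `∏_{u ∈ S∖R} y {e u, e (t u)}` gives at
most `Y ^ n` — a leaf's position occurs in exactly one line.  (The inequality form of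
`BattleFederbush.Script.sum_lineWeightProd_eq_prod_sum`; same induction as
`PolymerTreeSum.sum_lineProd_le`.) [folklore] -/
theorem sum_pos_prod_le {y : Sym2 β → ℝ} (hy : ∀ ℓ, 0 ≤ y ℓ) {Y : ℝ}
    (hY : ∀ a : β, ∑ a', y s(a, a') ≤ Y) (b : β) :
    ∀ (n : ℕ) (S R : Finset α) (t : α → α), (S \ R).card = n → R ⊆ S → IsForestOn S R t →
      ∑ e ∈ Fintype.piFinset (fun i => if i ∈ S \ R then (univ : Finset β) else {b}),
        ∏ i ∈ S \ R, y s(e i, e (t i)) ≤ Y ^ n := by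
  intro n
  induction n with
  | zero =>
    intro S R t hcard hRS ht
    have hSR : S \ R = ∅ := card_eq_zero.1 hcard
    have hpos : Fintype.piFinset (fun i => if i ∈ S \ R then (univ : Finset β) else {b})
        = ({fun _ => b} : Finset (α → β)) := by
      ext e
      rw [mem_pos, mem_singleton, hSR]
      constructor
      · intro h; funext i; exact h i (by simp)
      · rintro rfl; exact fun _ _ => rfl
    rw [hpos, sum_singleton, pow_zero, hSR, prod_empty]
  | succ n ih =>
    intro S R t hcard hRS ht
    have hne : (S \ R).Nonempty := card_pos.1 (by omega)
    obtain ⟨ℓ, hℓ, hleaf⟩ := exists_leaf ht hne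
    have hℓR : ℓ ∉ R := (mem_sdiff.1 hℓ).2
    have htℓ : t ℓ ≠ ℓ := apply_ne_self_of_mem_sdiff ht hℓ
    -- the smaller forest: drop the leaf
    set S' := S.erase ℓ with hS'
    set t' := Function.update t ℓ ℓ with ht'
    have hS'R : S' \ R = (S \ R).erase ℓ := by
      ext i; simp [hS', mem_sdiff, mem_erase]; tauto
    have hcard' : (S' \ R).card = n := by
      rw [hS'R, card_erase_of_mem hℓ, hcard]; rfl
    have hRS' : R ⊆ S' := by
      intro r hr
      rw [hS', mem_erase]
      exact ⟨fun h => hℓR (h ▸ hr), hRS hr⟩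
    have ht'_of_ne : ∀ i, i ≠ ℓ → t' i = t i := fun i hi => by simp [ht', hi]
    have hforest' : IsForestOn S' R t' := by
      refine ⟨fun v hv => ?_, fun v hv => ?_⟩
      · by_cases hvl : v = ℓ
        · subst hvl; simp [ht']
        · rw [ht'_of_ne v hvl]
          refine ht.1 v ?_
          intro hv'
          apply hv
          rw [mem_sdiff] at hv' ⊢
          exact ⟨by rw [hS', mem_erase]; exact ⟨hvl, hv'.1⟩, hv'.2⟩
      · have hvS : v ∈ S := (mem_erase.1 (by rw [hS'] at hv; exact hv)).2
        have hvl : v ≠ ℓ := (mem_erase.1 (by rw [hS'] at hv; exact hv)).1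
        obtain ⟨m, hm⟩ := ht.2 v hvS
        refine ⟨m, ?_⟩
        have havoid : ∀ k, t^[k] v ≠ ℓ := by
          intro k
          induction k with
          | zero => simpa using hvl
          | succ k ihk =>
            rw [Function.iterate_succ_apply']
            intro hk
            have hkS : t^[k] v ∈ S := ht.iterate_mem hRS hvS k
            by_cases hkR : t^[k] v ∈ R
            · rw [ht.apply_of_mem_roots hkR] at hk
              exact ihk hk
            · exact hleaf _ (mem_sdiff.2 ⟨hkS, hkR⟩) hk
        have hiter : ∀ k, t'^[k] v = t^[k] v := by
          intro k
          induction k with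
          | zero => rfl
          | succ k ihk =>
            rw [Function.iterate_succ_apply', Function.iterate_succ_apply', ihk, ht'_of_ne _ (havoid k)]
        rw [hiter]; exact hm
    have IH := ih S' R t' hcard' hRS' hforest'
    -- split the position sum along the coordinate ℓ
    have hsplit : ∑ e ∈ Fintype.piFinset (fun i => if i ∈ S \ R then (univ : Finset β) else {b}),
          ∏ i ∈ S \ R, y s(e i, e (t i))
        = ∑ e' ∈ Fintype.piFinset (fun i => if i ∈ S' \ R then (univ : Finset β) else {b}),
            ∑ a : β, ∏ i ∈ S \ R, y s(Function.update e' ℓ a i, Function.update e' ℓ a (t i)) := by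
      rw [← sum_product']
      symm
      refine sum_nbij' (fun p => Function.update p.1 ℓ p.2) (fun e => (Function.update e ℓ b, e ℓ))
        ?_ ?_ ?_ ?_ ?_
      · rintro ⟨e', a⟩ hp
        rw [mem_product] at hp
        obtain ⟨he', -⟩ := hp
        rw [mem_pos] at he' ⊢
        intro i hi
        have hil : i ≠ ℓ := fun h => hi (h ▸ hℓ)
        rw [Function.update_of_ne hil]
        exact he' i (by rw [hS'R]; intro h; exact hi (mem_of_mem_erase h))
      · intro e he
        rw [mem_product, mem_pos]
        rw [mem_pos] at he
        refine ⟨fun i hi => ?_, mem_univ _⟩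
        dsimp only
        by_cases hil : i = ℓ
        · subst hil; simp
        · rw [Function.update_of_ne hil]
          apply he i
          intro h
          apply hi
          rw [hS'R]
          exact mem_erase.2 ⟨hil, h⟩
      · rintro ⟨e', a⟩ hp
        rw [mem_product] at hp
        have hb : e' ℓ = b := (mem_pos.1 hp.1) ℓ (by rw [hS'R]; exact notMem_erase ℓ _)
        simp only [Function.update_idem, Function.update_self, Prod.mk.injEq, and_true]
        rw [Function.update_eq_self_iff]
        exact hb.symm
      · intro e _
        simp
      · intro p _; rfl
    -- factor the line product: the leaf's line, times a product which does not see the leaf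
    have hfactor : ∀ (e' : α → β) (a : β),
        ∏ i ∈ S \ R, y s(Function.update e' ℓ a i, Function.update e' ℓ a (t i))
          = y s(e' (t ℓ), a) * ∏ i ∈ S' \ R, y s(e' i, e' (t' i)) := by
      intro e' a
      rw [hS'R, ← mul_prod_erase (S \ R) _ hℓ]
      congr 1
      · rw [Function.update_self, Function.update_of_ne htℓ, Sym2.eq_swap]
      · refine prod_congr rfl (fun i hi => ?_)
        have hil : i ≠ ℓ := (mem_erase.1 hi).1
        have hiSR : i ∈ S \ R := (mem_erase.1 hi).2
        rw [Function.update_of_ne hil, ht'_of_ne i hil, Function.update_of_ne (hleaf i hiSR)]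
    have hY0 : 0 ≤ Y := le_trans (sum_nonneg (fun a' _ => hy s(b, a'))) (hY b)
    rw [hsplit]
    set P' := Fintype.piFinset (fun i => if i ∈ S' \ R then (univ : Finset β) else {b}) with hP'
    calc ∑ e' ∈ P', ∑ a : β, ∏ i ∈ S \ R, y s(Function.update e' ℓ a i, Function.update e' ℓ a (t i))
        = ∑ e' ∈ P', (∑ a : β, y s(e' (t ℓ), a)) * ∏ i ∈ S' \ R, y s(e' i, e' (t' i)) := by
          refine sum_congr rfl (fun e' _ => ?_)
          rw [sum_mul]
          exact sum_congr rfl (fun a _ => hfactor e' a)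
      _ ≤ ∑ e' ∈ P', Y * ∏ i ∈ S' \ R, y s(e' i, e' (t' i)) := by
          refine sum_le_sum (fun e' _ => ?_)
          exact mul_le_mul_of_nonneg_right (hY _) (prod_nonneg fun _ _ => hy _)
      _ = Y * ∑ e' ∈ P', ∏ i ∈ S' \ R, y s(e' i, e' (t' i)) := by rw [mul_sum]
      _ ≤ Y * Y ^ n := mul_le_mul_of_nonneg_left IH hY0
      _ = Y ^ (n + 1) := by ring

end Peel

end Summit.QuantumFields.YangMills.Theorems.AnchorGap.TreeSum
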